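import Summits.AtomisticToContinuum.FouriersLaw.Theses.JunctionLocality
import Literature.Barriers.AtomisticToContinuum.HarmonicCrystalBallisticProofs

/-!
# `SuperadditiveResistance` / Negative (2/2): tightness at the harmonic corner

Support file (`--supports stmt-AtomisticToContinuum-11748`) of the standing disprover seat.  At the family's
limit point `lam = β = 0` (pinned HARMONIC chain; outside the crux's parameter box), from the tree's exact
Rieder–Lebowitz–Lieb/Nakazawa solution (`harmonicNESS`, `fluxCoeff_eq`, `tendsto_fluxCoeff`): along
`harmonicNESS ω₂ γ` the response is `D_N = (N-1)·fluxCoeff ω₂ γ N`, positive for `N ≥ 2`, and the crux's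
conclusion FAILS for every constant `C < 1/fluxLimit ω₂ γ`
(`harmonic_corner_constant_ge_ballistic_resistance`); in particular pure superadditivity `C = 0` fails
(`harmonic_corner_not_superadditive`).  So the insertion constant is at least the ballistic resistance
`2(1+γ²)/(γ r(ω₂, γ))`, unbounded in `(ω₂, γ)`; granted continuity of the fixed-`N` response in `(lam, β)`
(not in the tree) the same lower bound transfers to small positive couplings, equivalently to low temperature by
the exact scaling `D_N(T; lam, β) = D_N(1; lam T, β T)`.  No new definitions.
cdisprove seat refuter-cdisprove-stmt-AtomisticToContinuum-11748-0, 2026-08-16.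
-/

noncomputable section

namespace Summit.AtomisticToContinuum.FouriersLaw.Theorems.SuperadditiveResistance.Negative

open MeasureTheory Filter Topology
open Literature.MathematicalPhysics.KineticTheory.HeatConduction
open Summit.AtomisticToContinuum.FouriersLaw.Theses

/-! ## Tightness at the harmonic corner (`lam = β = 0`, excluded by the crux but its limit point) -/

/-- **At the harmonic corner the insertion constant is at least the ballistic resistance.**  For
`pinnedChain ω₂ 0 0 γ` (`ω₂, γ > 0`) along the explicit Gaussian family `harmonicNESS ω₂ γ`: steady
states for all `N` and `T_L, T_R > 0`; for every `T > 0` the response limits exist and equal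
`D_N = (N-1)·fluxCoeff ω₂ γ N` (so `R_N = 1/fluxCoeff ω₂ γ N` for `N ≥ 2`), `D_N > 0` for `N ≥ 2`,
and for every `C < 1/fluxLimit ω₂ γ` the conclusion of (A) FAILS (`R_N + R_M - R_{N+M} → 1/c_∞` as
`N, M → ∞`, `tendsto_fluxCoeff`).  Since `1/fluxLimit ω₂ γ = 2(1+γ²)/(γ r) → ∞` as `ω₂ → ∞` or
`γ → 0, ∞`, no `(ω₂, γ)`-uniform constant survives near the corner.  (The corner itself satisfies
(A) with a larger constant — `R_N` is bounded there — which is the route's `HarmonicCalibration`.) [folklore] -/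
theorem harmonic_corner_constant_ge_ballistic_resistance {ω₂ γ : ℝ} (hω : 0 < ω₂) (hγ : 0 < γ) :
    ∃ μ : (N : ℕ) → ℝ → ℝ → Measure (PhaseSpace N),
      (∀ (N : ℕ) (T_L T_R : ℝ), 0 < T_L → 0 < T_R →
          (pinnedChain ω₂ 0 0 γ).IsSteadyState N T_L T_R (μ N T_L T_R)) ∧
      ∀ T : ℝ, 0 < T → ∃ D : ℕ → ℝ,
        (∀ N : ℕ, Tendsto (fun δ : ℝ =>
            (pinnedChain ω₂ 0 0 γ).totalCurrent (μ N (T + δ / 2) (T - δ / 2)) / δ)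
          (𝓝[≠] 0) (𝓝 (D N))) ∧
        (∀ N : ℕ, D N = ((N : ℝ) - 1) * fluxCoeff ω₂ γ N) ∧
        (∀ N : ℕ, 2 ≤ N → 0 < D N) ∧
        ∀ C : ℝ, C < 1 / fluxLimit ω₂ γ →
          ¬ ∀ N M : ℕ, 2 ≤ N → 2 ≤ M →
            ((N : ℝ) - 1) / D N + ((M : ℝ) - 1) / D M - C ≤ ((N : ℝ) + (M : ℝ) - 1) / D (N + M) := by
  set P := pinnedChain ω₂ 0 0 γ with hP
  refine ⟨fun N a b => harmonicNESS ω₂ γ N a b,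
    fun N T_L T_R hL hR => isSteadyState_harmonicNESS hω hγ N hL hR, fun T hT => ?_⟩
  set D : ℕ → ℝ := fun N => ((N : ℝ) - 1) * fluxCoeff ω₂ γ N with hDdef
  have hcpos : ∀ N : ℕ, 2 ≤ N → 0 < fluxCoeff ω₂ γ N := by
    intro N hN
    rw [fluxCoeff_eq hω hγ (show 1 < N by omega)]
    have hr := rootR_pos hω hγ
    positivity
  refine ⟨D, fun N => ?_, fun N => rfl, fun N hN => ?_, fun C hC => ?_⟩
  · -- the response limit along the Gaussian family
    cases N with
    | zero =>
      have h0 : D 0 = 0 := by simp [hDdef, fluxCoeff]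
      rw [h0]
      refine (tendsto_const_nhds (x := (0 : ℝ))).congr' ?_
      filter_upwards with δ
      simp [OscillatorChain.totalCurrent_zero]
    | succ M =>
      have hconst : ∀ᶠ δ in 𝓝[≠] (0 : ℝ),
          P.totalCurrent (harmonicNESS ω₂ γ (M + 1) (T + δ / 2) (T - δ / 2)) / δ = D (M + 1) := by
        have h2 : ∀ᶠ δ in 𝓝 (0 : ℝ), δ < 2 * T := eventually_lt_nhds (by linarith)
        have h2' : ∀ᶠ δ in 𝓝 (0 : ℝ), -(2 * T) < δ := eventually_gt_nhds (by linarith)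
        have hne : ∀ᶠ δ in 𝓝[≠] (0 : ℝ), δ ≠ 0 := eventually_mem_nhdsWithin
        filter_upwards [mem_nhdsWithin_of_mem_nhds h2, mem_nhdsWithin_of_mem_nhds h2', hne]
          with δ hlt hgt hδ
        have ha : 0 < T + δ / 2 := by linarith
        have hb : 0 < T - δ / 2 := by linarith
        rw [P.totalCurrent_eq_of_forall _ (fluxCoeff ω₂ γ (M + 1) * δ)]
        · simp only [hDdef]; push_cast; field_simp; ring
        · intro i hi
          rw [hP, integral_bondCurrent_harmonicNESS_eq_fluxCoeff' hω hγ ha hb i hi]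
          ring
      exact (tendsto_const_nhds).congr' (hconst.mono fun δ hδ => hδ.symm)
  · -- positivity for `N ≥ 2`
    have h1 : (1 : ℝ) < N := by exact_mod_cast hN
    have := hcpos N hN
    simp only [hDdef]
    exact mul_pos (by linarith) this
  · -- the defect tends to the ballistic resistance `1/c_∞ > C`
    intro hall
    have hR : ∀ N : ℕ, 2 ≤ N → ((N : ℝ) - 1) / D N = (fluxCoeff ω₂ γ N)⁻¹ := by
      intro N hN
      have h1 : (N : ℝ) - 1 ≠ 0 := by
        have : (1 : ℝ) < N := by exact_mod_cast hN
        linarith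
      simp only [hDdef]
      rw [div_mul_eq_div_div, div_self h1, one_div]
    have hlim : Tendsto (fun N : ℕ => (fluxCoeff ω₂ γ N)⁻¹) atTop (𝓝 (fluxLimit ω₂ γ)⁻¹) :=
      (tendsto_fluxCoeff hω hγ).inv₀ (fluxLimit_pos hω hγ).ne'
    have hCinv : C < (fluxLimit ω₂ γ)⁻¹ := by rwa [one_div] at hC
    set ε : ℝ := ((fluxLimit ω₂ γ)⁻¹ - C) / 4 with hε
    have hεpos : 0 < ε := by rw [hε]; linarith
    have hev : ∀ᶠ N : ℕ in atTop,
        (fluxLimit ω₂ γ)⁻¹ - ε < (fluxCoeff ω₂ γ N)⁻¹ ∧ (fluxCoeff ω₂ γ N)⁻¹ < (fluxLimit ω₂ γ)⁻¹ + ε :=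
      hlim.eventually (Ioo_mem_nhds (by linarith) (by linarith))
    obtain ⟨N₀, hN₀⟩ := eventually_atTop.mp hev
    set N := max N₀ 2 with hNdef
    have hN2 : 2 ≤ N := le_max_right _ _
    have hN0 : N₀ ≤ N := le_max_left _ _
    have hNN : 2 ≤ N + N := by omega
    have hlow := (hN₀ N hN0).1
    have hup := (hN₀ (N + N) (by omega)).2
    have key := hall N N hN2 hN2
    have h3 : ((N : ℝ) + (N : ℝ) - 1) / D (N + N) = (fluxCoeff ω₂ γ (N + N))⁻¹ := by
      rw [← hR (N + N) hNN]; push_cast; ring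
    rw [hR N hN2, h3] at key
    linarith

/-- In particular PURE superadditivity (`C = 0`) fails at the harmonic corner. [folklore] -/
theorem harmonic_corner_not_superadditive {ω₂ γ : ℝ} (hω : 0 < ω₂) (hγ : 0 < γ) :
    ∃ μ : (N : ℕ) → ℝ → ℝ → Measure (PhaseSpace N),
      (∀ (N : ℕ) (T_L T_R : ℝ), 0 < T_L → 0 < T_R →
          (pinnedChain ω₂ 0 0 γ).IsSteadyState N T_L T_R (μ N T_L T_R)) ∧
      ∀ T : ℝ, 0 < T → ∃ D : ℕ → ℝ,
        (∀ N : ℕ, Tendsto (fun δ : ℝ =>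
            (pinnedChain ω₂ 0 0 γ).totalCurrent (μ N (T + δ / 2) (T - δ / 2)) / δ)
          (𝓝[≠] 0) (𝓝 (D N))) ∧
        (∀ N : ℕ, 2 ≤ N → 0 < D N) ∧
        ¬ ∀ N M : ℕ, 2 ≤ N → 2 ≤ M →
            ((N : ℝ) - 1) / D N + ((M : ℝ) - 1) / D M ≤ ((N : ℝ) + (M : ℝ) - 1) / D (N + M) := by
  obtain ⟨μ, hμ, h⟩ := harmonic_corner_constant_ge_ballistic_resistance hω hγ
  refine ⟨μ, hμ, fun T hT => ?_⟩
  obtain ⟨D, hD, -, hpos, hC⟩ := h T hT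
  refine ⟨D, hD, hpos, fun hall => hC 0 (by simpa using fluxLimit_pos hω hγ) ?_⟩
  intro N M hN hM
  simpa using hall N M hN hM

end Summit.AtomisticToContinuum.FouriersLaw.Theorems.SuperadditiveResistance.Negative

end
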